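import Summits.ResolutionOfSingularities.ResolutionOfSingularities.Theorems.EquisingularLiftEquisingularLiftNatP1VBReductionSections
import Literature.AlgebraicGeometry.Resolution.PrincipalizationToResolution
import Literature.AlgebraicGeometry.Motives.ProjectiveLineUniformisers
import Literature.AlgebraicGeometry.Motives.AlgebraicEquivalenceRatLeAlgProofs
import Literature.AlgebraicGeometry.Morphisms.CechH1Projective
import Mathlib.AlgebraicGeometry.IdealSheaf.IrreducibleComponent
import Mathlib.AlgebraicGeometry.Morphisms.Proper
import Mathlib.AlgebraicGeometry.Noetherian
import HarnessLib

/-!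
# [OURS · L1 W4.5(b) · LINE (T-j)-PROOF, GLUE G1] A proper regular scheme over a local ring whose closed fibre is a projective
# line is integral

Cell res-hironaka, LADDER-RESOLUTION rung L, slot W4.5(b), crux chain w45b: EL♮(3) = stmt-ResolutionOfSingularities-20148, residue
(T-j) = F-102 `Literature.AlgebraicGeometry.Resolution.GenusZeroOverCompleteDVR` (LINE (T-j)-PROOF, res-L1-w45b-lead-2 g3; skeleton
`L/res-L1-w45b-lead-2/F102Skeleton.lean` v2, glue G1 `isIntegral_of_isRegular`, binders verbatim). `--supports
stmt-ResolutionOfSingularities-20148 --as helper`. NOT a statement of any manuscript; OURS; AI-written, weaker than expert review. No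
`sorry`; standard axioms; DEF-FREE.

THEOREM (`isIntegral_of_isRegular`). `O` a discrete valuation ring, `θ : O ↠ k` onto a field, `f : C → Spec O` proper (flatness and
completeness are carried for uniformity with the skeleton but not used), `C` regular, `(i, t)` cartesian over `Spec θ` with `Ck ≅ ℙ¹_{k'}`.
Then `C` is integral.

PROOF. Regular ⇒ reduced (tree `Scheme.IsRegular.isReduced`). Irreducible: the irreducible components of the Noetherian regular `C`
are open (tree `Scheme.IsRegular.coe_irreducibleComponentOpen`) and pairwise disjoint (`Scheme.IsRegular.eq_of_mem_irreducibleComponents`);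
every point specialises to a closed point, which lies on the closed fibre `i(Ck)` (`f` is a closed map); `i(Ck)` is irreducible
(`ℙ¹_{k'}` is integral), so two components meeting it meet each other there, hence coincide; thus the component through a point of
the closed fibre is everything.
-/

noncomputable section

open CategoryTheory AlgebraicGeometry TopologicalSpace Opposite IsLocalRing
open Literature.AlgebraicGeometry Literature.AlgebraicGeometry.Resolution Literature.AlgebraicGeometry.Motives

set_option linter.dupNamespace false -- mandated namespace `Summit.<Summit>.<Problem>` of this single-conjunct summit

namespace Summit.ResolutionOfSingularities.ResolutionOfSingularities.Cruxes.EquisingularLiftNat.F102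

/-- In a Noetherian regular scheme, a point specialising into an irreducible component lies in it (components are open).
[folklore] -/
theorem mem_of_specializes_of_mem_irreducibleComponents {Z : Scheme.{0}} [IsNoetherian Z] (hZ : Scheme.IsRegular Z)
    {D : Set Z} (hD : D ∈ irreducibleComponents Z) {y c : Z} (hyc : y ⤳ c) (hc : c ∈ D) : y ∈ D := by
  have hopen : IsOpen D := by
    rw [← hZ.coe_irreducibleComponentOpen hD]
    exact (Z.irreducibleComponentOpen D).isOpen
  exact hyc.mem_open hopen hc

/-- **GLUE G1 — `C` is integral.** `f : C → Spec O` proper with `C` regular and closed fibre `Ck ≅ ℙ¹_{k'}` (cartesian square over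
`Spec θ`, `θ : O ↠ k`): `C` is reduced and irreducible. [OURS] -/
theorem isIntegral_of_isRegular (O : Type) [CommRing O] [IsDomain O] [IsDiscreteValuationRing O]
    [IsAdicComplete (maximalIdeal O) O] (k : Type) [Field k] [IsAlgClosed k] (θ : O →+* k)
    (C : Scheme.{0}) (f : C ⟶ Spec (.of O)) [IsProper f] [Flat f]
    (Ck : Scheme.{0}) (i : Ck ⟶ C) (t : Ck ⟶ Spec (.of k))
    (hθ : Function.Surjective θ) (hreg : Resolution.Scheme.IsRegular C)
    (hsq : IsPullback i t f (Spec.map (CommRingCat.ofHom θ)))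
    (hP1 : ∃ (k' : Type) (_ : Field k'), Nonempty (Ck ≅ Morphisms.ProjCech.PP k' 1)) : IsIntegral C := by
  obtain ⟨k', _, ⟨e⟩⟩ := hP1
  haveI : IsLocallyNoetherian C := LocallyOfFiniteType.isLocallyNoetherian f
  haveI : CompactSpace C := QuasiCompact.compactSpace_of_compactSpace f
  haveI : IsNoetherian C := {}
  haveI : IsReduced C := hreg.isReduced
  haveI : IsClosedImmersion i := P1VB.isClosedImmersion_of_isPullback θ f hθ hsq
  -- the closed fibre `i(Ck)` is irreducible and consists of the points over the closed point
  haveI : IrreducibleSpace (ProjLine.P k') := by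
    haveI : IsIntegral (ProjLine.Pover k').left := inferInstance
    exact (inferInstance : IrreducibleSpace (ProjLine.Pover k').left)
  haveI : IrreducibleSpace Ck := e.symm.hom.homeomorph.irreducibleSpace_iff.mp inferInstance
  have hirr : IsIrreducible (Set.range i.base) := by
    rw [← Set.image_univ]
    exact (IrreducibleSpace.isIrreducible_univ Ck).image i.base i.base.hom.continuous.continuousOn
  have hker : RingHom.ker θ = maximalIdeal O := IsLocalRing.eq_maximalIdeal (RingHom.ker_isMaximal_of_surjective θ hθ)
  haveI : IsLocalHom θ := by
    refine ⟨fun a ha => ?_⟩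
    by_contra h
    have hmem : a ∈ RingHom.ker θ := by rw [hker]; exact (IsLocalRing.mem_maximalIdeal a).mpr h
    exact ha.ne_zero ((RingHom.mem_ker).mp hmem)
  have hrange : ∀ c : C, f.base c = closedPoint O → c ∈ Set.range i.base := fun c hc => by
    have h1 : Set.range i.base = f.base ⁻¹' Set.range (Spec.map (CommRingCat.ofHom θ)).base := by
      have hs : Function.Surjective hsq.isoPullback.hom.base := hsq.isoPullback.hom.homeomorph.surjective
      rw [← hsq.isoPullback_hom_fst, Scheme.Hom.comp_base, TopCat.coe_comp, hs.range_comp,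
        Scheme.Pullback.range_fst]
    rw [h1, Set.mem_preimage, hc]
    exact ⟨closedPoint k, Spec_closedPoint (f := CommRingCat.ofHom θ)⟩
  -- every point specialises to a closed point, which lies on the closed fibre
  have hclosed : ∀ y : C, ∃ c : C, y ⤳ c ∧ c ∈ Set.range i.base := fun y => by
    obtain ⟨c, hc, hccl⟩ := (isClosed_closure (s := ({y} : Set C))).exists_closed_singleton
      ⟨y, subset_closure (Set.mem_singleton y)⟩
    refine ⟨c, specializes_iff_mem_closure.mpr hc, hrange c ?_⟩
    have himg : IsClosed ({f.base c} : Set ↥(Spec (.of O))) := by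
      rw [← Set.image_singleton]; exact f.isClosedMap _ hccl
    exact PrimeSpectrum.ext (IsLocalRing.eq_maximalIdeal
      ((PrimeSpectrum.isClosed_singleton_iff_isMaximal _).mp himg))
  -- the component through a point of the closed fibre is everything
  obtain ⟨x₀, hx₀⟩ : (Set.range i.base).Nonempty := hirr.nonempty
  set D := irreducibleComponent x₀ with hD
  have hDc : D ∈ irreducibleComponents C := irreducibleComponent_mem_irreducibleComponents x₀
  have hDall : ∀ y : C, y ∈ D := fun y => by
    obtain ⟨c, hyc, hc⟩ := hclosed y
    set D' := irreducibleComponent c with hD'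
    have hD'c : D' ∈ irreducibleComponents C := irreducibleComponent_mem_irreducibleComponents c
    -- `D` and `D'` are open and both meet the irreducible closed fibre, hence meet each other there
    have hopen : ∀ {E : Set C}, E ∈ irreducibleComponents C → IsOpen E := fun hE => by
      rw [← hreg.coe_irreducibleComponentOpen hE]; exact (C.irreducibleComponentOpen _).isOpen
    obtain ⟨z, hz, hzD, hzD'⟩ := hirr.isPreirreducible D D' (hopen hDc) (hopen hD'c)
      ⟨x₀, hx₀, mem_irreducibleComponent⟩ ⟨c, hc, mem_irreducibleComponent⟩
    have hDD' : D = D' := hreg.eq_of_mem_irreducibleComponents z hDc hD'c hzD hzD'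
    rw [hDD']
    exact mem_of_specializes_of_mem_irreducibleComponents hreg hD'c hyc mem_irreducibleComponent
  haveI : IrreducibleSpace C := by
    have hDu : D = Set.univ := Set.eq_univ_of_forall hDall
    have huniv : IsIrreducible (Set.univ : Set C) := hDu ▸ isIrreducible_irreducibleComponent
    haveI : PreirreducibleSpace C := ⟨huniv.isPreirreducible⟩
    exact ⟨⟨x₀⟩⟩
  exact isIntegral_of_irreducibleSpace_of_isReduced C

end Summit.ResolutionOfSingularities.ResolutionOfSingularities.Cruxes.EquisingularLiftNat.F102

end
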